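import Summits.BirchSwinnertonDyer.BirchSwinnertonDyer.Theorems.CycTangentCMCycTangentBoundFrameSignRoots
import Summits.BirchSwinnertonDyer.Rank1Residual.X11b.FramePrincipalUnitPowers
import Literature.NumberTheory.EllipticCurves.IntSeriesIdentityPrinciple
import Literature.NumberTheory.EllipticCurves.PAdicLFunctionInterpolationProofs
import HarnessLib

set_option linter.dupNamespace false
set_option autoImplicit false

/-!
# Crux `CycTangentCM.CycTangentBound` (stmt-BirchSwinnertonDyer-22628), negative road:
# PERIOD RIGIDITY — two frames for the same data on a `ℤ_p`-line have the same VALUE NORMS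
# (the ratio of the `p`-adic periods is a unit, and a `1`-unit up to the fixed weight power)

Seat `bsd-line-ctcm-p4` (D-0145 line `route-BirchSwinnertonDyer-CycTangentCM`, helper file,
`--supports 22628`).  The lead's negative twin
`CycTangentBoundNegative.cycTangentBound_false_of_splitPrimeLineCertificate` (p591225) takes a
NUMERICAL hypothesis quantified over ALL frames `(Ω, δ, Ω_p, G)` of the crux at the witness curve; the
numbers are computed at ONE normalisation (Néron period, one `p`-adic period).  The companion file
`Literature/…/KatzFramePeriodRescaling` (-p5, p591738) removes the complex period (`IsKatzMeasure₂` is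
invariant under `(Ω, Ω_p) ↦ (Ω·x, Ω_p·ι⁻¹x)`), so two frames with the same character data differ only in
the `p`-adic period: on a `ℤ_p`-line with nodes `uⁿ − 1` and weights `m_n = a + b·n` their values are
`I_n · Ω_p^{a+bn}` and `I_n · Ω_p'^{a+bn}` with the SAME algebraic parts `I_n`
(`CycTangentCMCycTangentBoundSplitPrimePowerLine.exists_splitPrimeLine_powerLine`, p588596).  This file
proves that the value NORMS then agree — «frame-invariance of value norms by `p`-adic continuity»:

* §1 `1`-units: the converse of the tree's `X11b.tendsto_pow_prime_pow_padicComplex`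
  (`‖u − 1‖ < 1 ⟹ u^{pⁿ} → 1`): `D^{pⁿ} → 1 ⟹ ‖D − 1‖ < 1` (`norm_sub_one_lt_one_of_tendsto`, via
  `‖(1+E)^{pⁿ} − 1‖ = 1` for `‖E‖ = 1`, -p2's `norm_one_add_pow_prime_sub_one_eq_one`);
* §2 the Lipschitz property of `F ∈ 𝒪_{ℂ_p}⟦T⟧` on the open disc, `‖F(x) − F(y)‖ ≤ ‖x − y‖`, and
  continuity of values along convergent nodes;
* §3 **CORE** `norm_sub_one_lt_one_of_values_mul_pow`: if `F, F' ∈ 𝒪_{ℂ_p}⟦T⟧` take values `x_t`,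
  `y_t = c·D^t·x_t` (`c, D ≠ 0`) at the nodes `u^t − 1` (`‖u − 1‖ < 1`) and some `x_{t₀} ≠ 0`, then
  `D` is a PRINCIPAL UNIT: along `t₀ + pⁿ → t₀` (`p`-adically) both value sequences converge
  (§2), forcing `D^{pⁿ} → 1`;
* §4 `norm_values_eq_of_two_periods`: the frame-shaped corollary — value supplies
  `I_n·Ω_p^{a+bn}`, `I_n·Ω_p'^{a+bn}` (`b ≠ 0`, `Ω_p, Ω_p' ≠ 0`, one `I_{n₀} ≠ 0`) give
  `‖Ω_p'/Ω_p‖ = 1`, `(Ω_p'/Ω_p)^b` a `1`-unit, and `‖I_n Ω_p'^{a+bn}‖ = ‖I_n Ω_p^{a+bn}‖` for all `n`.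

So in the numerical hypothesis of the negative road the `∀ frames` costs nothing beyond ONE frame:
norm conditions (forward-difference / two-point certificates) transfer verbatim between frames.
THEOREMS ONLY (no definition, no named fact, no `sorry`); nothing is closed; the crux is not
claimed false HERE; BSD is not proved by any of this.

References: [Gouvea1993PadicNumbers] §5.6 (functions defined by bounded power series on discs),
§5.7 (`1`-units); [Washington1997] §5.1–§5.2 (`p`-adic continuity along `a + pⁿℤ_p`, power series
from values); [deShalit1987] II.4.12 Remark (p. 66–67) (the period pair `(Ω, Ω_p)` is determined up to
a common scalar; the `p`-adic period up to a unit).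
-/

noncomputable section

open Filter Topology
open Literature.NumberTheory.EllipticCurves
open Summit.BirchSwinnertonDyer.BirchSwinnertonDyer.Theorems.CycTangentCMCycTangentBoundFrameSignRoots
open Summit.BirchSwinnertonDyer.Rank1Residual.X11b

namespace Summit.BirchSwinnertonDyer.BirchSwinnertonDyer.Theorems.CycTangentCMCycTangentBoundPeriodRigidity

variable {p : ℕ} [hp : Fact p.Prime]

/-! ## §1 One-units: `D^{pⁿ} → 1` forces `D` to be a one-unit -/

-- `‖p‖ < 1` in `ℂ_p`: `Literature.NumberTheory.EllipticCurves.norm_prime_padicComplex_lt_one`;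
-- `u^{pⁿ} → 1` for a `1`-unit: `X11b.tendsto_pow_prime_pow_padicComplex`;
-- `‖u‖ = 1` for a `1`-unit: `X11b.R1.norm_eq_one_of_norm_sub_one_lt`.


/-- `‖(1+E)^{pⁿ} − 1‖ = 1` whenever `‖E‖ = 1`: a unit that is NOT a `1`-unit stays away from `1`
under `p`-power maps. [cite: Gouvea1993PadicNumbers, §5.7] -/
theorem norm_one_add_pow_prime_pow_sub_one_eq_one {E : ℂ_[p]} (hE : ‖E‖ = 1) (n : ℕ) :
    ‖(1 + E) ^ p ^ n - 1‖ = 1 := by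
  induction n with
  | zero => simpa using hE
  | succ n ih =>
    have hstep : (1 + E) ^ p ^ (n + 1) - 1 = (1 + ((1 + E) ^ p ^ n - 1)) ^ p - 1 := by
      rw [add_sub_cancel, pow_succ, pow_mul]
    rw [hstep]
    exact norm_one_add_pow_prime_sub_one_eq_one p norm_prime_padicComplex_lt_one ih

/-- **If `D^{pⁿ} → 1` then `D` is a `1`-unit (`‖D − 1‖ < 1`).**  Eventually `‖D^{pⁿ} − 1‖ < 1`, so
`‖D‖ = 1`; were `‖D − 1‖ = 1`, every `‖D^{pⁿ} − 1‖` would equal `1`. [cite: Gouvea1993PadicNumbers, §5.7] -/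
theorem norm_sub_one_lt_one_of_tendsto {D : ℂ_[p]}
    (h : Tendsto (fun n : ℕ ↦ D ^ p ^ n) atTop (𝓝 1)) : ‖D - 1‖ < 1 := by
  have hev : ∀ᶠ n : ℕ in atTop, ‖D ^ p ^ n - 1‖ < 1 := by
    have := (tendsto_iff_norm_sub_tendsto_zero.mp h).eventually (gt_mem_nhds zero_lt_one)
    exact this
  obtain ⟨n, hn⟩ := hev.exists
  -- `‖D‖ = 1`
  have hDn : ‖D‖ = 1 := by
    have h1 : ‖D ^ p ^ n‖ = 1 := R1.norm_eq_one_of_norm_sub_one_lt hn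
    rw [norm_pow] at h1
    exact (pow_eq_one_iff_of_nonneg (norm_nonneg _) (pow_ne_zero _ hp.out.ne_zero)).mp h1
  have hle : ‖D - 1‖ ≤ 1 := norm_sub_one_le_one hDn.le
  rcases hle.lt_or_eq with hlt | heq
  · exact hlt
  · exfalso
    have := norm_one_add_pow_prime_pow_sub_one_eq_one heq n
    rw [add_sub_cancel] at this
    exact absurd this hn.ne

/-! ## §2 Values of `F ∈ 𝒪_{ℂ_p}⟦T⟧` are Lipschitz on the open disc -/

/-- `‖x^k − y^k‖ ≤ ‖x − y‖` for `‖x‖, ‖y‖ ≤ 1`. [folklore] -/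
theorem norm_pow_sub_pow_le_norm_sub {x y : ℂ_[p]} (hx : ‖x‖ ≤ 1) (hy : ‖y‖ ≤ 1) (k : ℕ) :
    ‖x ^ k - y ^ k‖ ≤ ‖x - y‖ := by
  have h := (Commute.all x y).geom_sum₂_mul k
  rw [← h, norm_mul]
  refine mul_le_of_le_one_left (norm_nonneg _) ?_
  refine IsUltrametricDist.norm_sum_le_of_forall_le_of_nonneg zero_le_one fun i _ ↦ ?_
  rw [norm_mul, norm_pow, norm_pow]
  exact mul_le_one₀ (pow_le_one₀ (norm_nonneg _) hx) (by positivity) (pow_le_one₀ (norm_nonneg _) hy)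

/-- **Lipschitz property**: values of `F ∈ 𝒪_{ℂ_p}⟦T⟧` at points `x, y` of the open unit disc satisfy
`‖F(x) − F(y)‖ ≤ ‖x − y‖`. [cite: Gouvea1993PadicNumbers, §5.6] -/
theorem norm_value_sub_value_le {F : PowerSeries (PadicComplexInt p)} {x y v w : ℂ_[p]}
    (hx : ‖x‖ < 1) (hy : ‖y‖ < 1) (hv : IntSeries.HasValueAt F x v) (hw : IntSeries.HasValueAt F y w) :
    ‖v - w‖ ≤ ‖x - y‖ := by
  set f : ℕ → ℂ_[p] := fun k ↦ ((PowerSeries.coeff k F : PadicComplexInt p) : ℂ_[p]) * x ^ k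
    with hf
  set g : ℕ → ℂ_[p] := fun k ↦ ((PowerSeries.coeff k F : PadicComplexInt p) : ℂ_[p]) * y ^ k
    with hg
  have hfv : HasSum f v := hv
  have hgw : HasSum g w := hw
  have hsub : HasSum (fun k ↦ f k - g k) (v - w) := hfv.sub hgw
  rw [← hsub.tsum_eq]
  refine IsUltrametricDist.norm_tsum_le_of_forall_le_of_nonneg (norm_nonneg _) fun k ↦ ?_
  rw [hf, hg]
  dsimp only
  rw [← mul_sub, norm_mul]
  calc ‖((PowerSeries.coeff k F : PadicComplexInt p) : ℂ_[p])‖ * ‖x ^ k - y ^ k‖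
      ≤ 1 * ‖x - y‖ := mul_le_mul (norm_coe_padicComplexInt_le_one _)
        (norm_pow_sub_pow_le_norm_sub hx.le hy.le k) (norm_nonneg _) zero_le_one
    _ = ‖x - y‖ := one_mul _

/-- **Continuity of values along convergent nodes**: if `x_n → a` inside the open unit disc then
`F(x_n) → F(a)`. [cite: Gouvea1993PadicNumbers, §5.6] -/
theorem tendsto_value {F : PowerSeries (PadicComplexInt p)} {x v : ℕ → ℂ_[p]} {a va : ℂ_[p]}
    (hx : ∀ n, ‖x n‖ < 1) (ha : ‖a‖ < 1) (hv : ∀ n, IntSeries.HasValueAt F (x n) (v n))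
    (hva : IntSeries.HasValueAt F a va) (h : Tendsto x atTop (𝓝 a)) :
    Tendsto v atTop (𝓝 va) := by
  rw [tendsto_iff_norm_sub_tendsto_zero] at h ⊢
  exact squeeze_zero (fun _ ↦ norm_nonneg _)
    (fun n ↦ norm_value_sub_value_le (hx n) ha (hv n) hva) h

/-! ## §3 CORE: the ratio character of two value supplies on one line is a one-unit -/

/-- The nodes `u^t − 1` of a `1`-unit `u` lie in the open unit disc. [folklore] -/
theorem norm_pow_sub_one_lt_one {u : ℂ_[p]} (hu : ‖u - 1‖ < 1) (t : ℕ) : ‖u ^ t - 1‖ < 1 :=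
  (R1.norm_pow_sub_one_le hu t).trans_lt hu

/-- Along `t₀ + pⁿ` the nodes converge to the node at `t₀`: `u^{t₀ + pⁿ} − 1 → u^{t₀} − 1`.
[cite: Washington1997, §5.1] -/
theorem tendsto_node {u : ℂ_[p]} (hu : ‖u - 1‖ < 1) (t₀ : ℕ) :
    Tendsto (fun n : ℕ ↦ u ^ (t₀ + p ^ n) - 1) atTop (𝓝 (u ^ t₀ - 1)) := by
  have h := ((tendsto_pow_prime_pow_padicComplex hu).const_mul (u ^ t₀)).sub_const 1
  simp only [mul_one] at h
  refine h.congr' (Eventually.of_forall fun n ↦ ?_)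
  simp [pow_add]

/-- **PERIOD RIGIDITY (core).**  Let `F, F' ∈ 𝒪_{ℂ_p}⟦T⟧` take the values `x_t` and
`y_t = c · D^t · x_t` at the nodes `u^t − 1` (`t ∈ ℕ`, `‖u − 1‖ < 1`), with `c ≠ 0`, `D ≠ 0`, and
suppose `x_{t₀} ≠ 0` for some `t₀`.  Then `D` is a PRINCIPAL UNIT: `‖D − 1‖ < 1`.
Proof: along `t = t₀ + pⁿ` the nodes tend to `u^{t₀} − 1`, so `x_t → x_{t₀}` and `y_t → y_{t₀}`
(§2); but `y_t = c D^{t₀} · D^{pⁿ} x_t`, whence `D^{pⁿ} x_t → x_{t₀} ≠ 0`, `D^{pⁿ} → 1`, and §1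
applies. [cite: Washington1997, §5.1–§5.2] [cite: deShalit1987, II.4.12 Remark (p. 66–67)] -/
theorem norm_sub_one_lt_one_of_values_mul_pow (F F' : PowerSeries (PadicComplexInt p))
    {u c D : ℂ_[p]} (hu : ‖u - 1‖ < 1) (hc : c ≠ 0) (hD : D ≠ 0) {x y : ℕ → ℂ_[p]}
    (hx : ∀ t, IntSeries.HasValueAt F (u ^ t - 1) (x t))
    (hy : ∀ t, IntSeries.HasValueAt F' (u ^ t - 1) (y t))
    (hxy : ∀ t, y t = c * D ^ t * x t) {t₀ : ℕ} (h0 : x t₀ ≠ 0) : ‖D - 1‖ < 1 := by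
  -- the subsequence `t₀ + pⁿ`
  set s : ℕ → ℕ := fun n ↦ t₀ + p ^ n with hs
  have hnode := tendsto_node hu t₀
  have hxlim : Tendsto (fun n ↦ x (s n)) atTop (𝓝 (x t₀)) :=
    tendsto_value (fun n ↦ norm_pow_sub_one_lt_one hu (s n)) (norm_pow_sub_one_lt_one hu t₀)
      (fun n ↦ hx (s n)) (hx t₀) hnode
  have hylim : Tendsto (fun n ↦ y (s n)) atTop (𝓝 (y t₀)) :=
    tendsto_value (fun n ↦ norm_pow_sub_one_lt_one hu (s n)) (norm_pow_sub_one_lt_one hu t₀)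
      (fun n ↦ hy (s n)) (hy t₀) hnode
  -- rewrite `y (s n) = (c D^{t₀}) · (D^{pⁿ} x (s n))`
  have hcD : c * D ^ t₀ ≠ 0 := mul_ne_zero hc (pow_ne_zero _ hD)
  have hz : Tendsto (fun n ↦ D ^ p ^ n * x (s n)) atTop (𝓝 (x t₀)) := by
    have h1 : Tendsto (fun n ↦ (c * D ^ t₀)⁻¹ * y (s n)) atTop (𝓝 ((c * D ^ t₀)⁻¹ * y t₀)) :=
      hylim.const_mul _
    have h2 : (c * D ^ t₀)⁻¹ * y t₀ = x t₀ := by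
      rw [hxy t₀, ← mul_assoc, inv_mul_cancel₀ hcD, one_mul]
    rw [h2] at h1
    refine h1.congr' (Eventually.of_forall fun n ↦ ?_)
    show (c * D ^ t₀)⁻¹ * y (s n) = D ^ p ^ n * x (s n)
    rw [hxy (s n), hs]
    simp only [pow_add]
    field_simp
  -- hence `D^{pⁿ} → 1`
  have hev : ∀ᶠ n in atTop, x (s n) ≠ 0 := hxlim.eventually_ne h0
  have hq : Tendsto (fun n ↦ D ^ p ^ n * x (s n) / x (s n)) atTop (𝓝 (x t₀ / x t₀)) :=
    hz.div hxlim h0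
  rw [div_self h0] at hq
  have hDlim : Tendsto (fun n : ℕ ↦ D ^ p ^ n) atTop (𝓝 1) := by
    refine hq.congr' (hev.mono fun n hn ↦ ?_)
    exact mul_div_cancel_right₀ _ hn
  exact norm_sub_one_lt_one_of_tendsto hDlim

/-- Under the hypotheses of `norm_sub_one_lt_one_of_values_mul_pow`, `‖D‖ = 1`.
[cite: deShalit1987, II.4.12 Remark (p. 66–67)] -/
theorem norm_eq_one_of_values_mul_pow (F F' : PowerSeries (PadicComplexInt p))
    {u c D : ℂ_[p]} (hu : ‖u - 1‖ < 1) (hc : c ≠ 0) (hD : D ≠ 0) {x y : ℕ → ℂ_[p]}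
    (hx : ∀ t, IntSeries.HasValueAt F (u ^ t - 1) (x t))
    (hy : ∀ t, IntSeries.HasValueAt F' (u ^ t - 1) (y t))
    (hxy : ∀ t, y t = c * D ^ t * x t) {t₀ : ℕ} (h0 : x t₀ ≠ 0) : ‖D‖ = 1 :=
  R1.norm_eq_one_of_norm_sub_one_lt
    (norm_sub_one_lt_one_of_values_mul_pow F F' hu hc hD hx hy hxy h0)

/-- `‖C‖ = 1` as soon as some power `C^b` (`b ≠ 0`) is a `1`-unit. [folklore] -/
theorem norm_eq_one_of_norm_pow_sub_one_lt_one {C : ℂ_[p]} {b : ℕ} (hb : b ≠ 0)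
    (h : ‖C ^ b - 1‖ < 1) : ‖C‖ = 1 := by
  have h1 : ‖C‖ ^ b = 1 := by rw [← norm_pow]; exact R1.norm_eq_one_of_norm_sub_one_lt h
  exact (pow_eq_one_iff_of_nonneg (norm_nonneg _) hb).mp h1

/-! ## §4 The frame-shaped corollary: value norms do not depend on the `p`-adic period -/

/-- **FRAME-INVARIANCE OF VALUE NORMS ON A LINE.**  Two one-variable branches `F, F' ∈ 𝒪_{ℂ_p}⟦T⟧`
with value supplies `F(uⁿ − 1) = I_n · Ω_p^{a + b n}` and `F'(uⁿ − 1) = I_n · Ω_p'^{a + b n}` at the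
nodes of a `1`-unit `u` — the SAME algebraic parts `I_n`, weights `a + b·n` with `b ≠ 0`, periods
`Ω_p, Ω_p' ≠ 0` (the literal output shape of `exists_splitPrimeLine_powerLine` for two frames of the
same character data after the rescaling `KatzFramePeriodRescaling`) — and ONE non-vanishing `I_{n₀} ≠ 0`:
then `‖Ω_p'/Ω_p‖ = 1`, `(Ω_p'/Ω_p)^b` is a `1`-unit, and ALL value norms agree,
`‖I_n Ω_p'^{a+bn}‖ = ‖I_n Ω_p^{a+bn}‖`.  So norm certificates (forward differences, two-point) read on
one frame hold on every frame. [cite: deShalit1987, II.4.12 Remark (p. 66–67)] [cite: Washington1997, §5.2] -/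
theorem norm_values_eq_of_two_periods (F F' : PowerSeries (PadicComplexInt p))
    {u Ωp Ωp' : ℂ_[p]} (hu : ‖u - 1‖ < 1) (hΩp : Ωp ≠ 0) (hΩp' : Ωp' ≠ 0)
    {I : ℕ → ℂ_[p]} {a b : ℕ} (hb : b ≠ 0)
    (hF : ∀ n, IntSeries.HasValueAt F (u ^ n - 1) (I n * Ωp ^ (a + b * n)))
    (hF' : ∀ n, IntSeries.HasValueAt F' (u ^ n - 1) (I n * Ωp' ^ (a + b * n)))
    {n₀ : ℕ} (h0 : I n₀ ≠ 0) :
    ‖Ωp' / Ωp‖ = 1 ∧ ‖(Ωp' / Ωp) ^ b - 1‖ < 1 ∧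
      ∀ n, ‖I n * Ωp' ^ (a + b * n)‖ = ‖I n * Ωp ^ (a + b * n)‖ := by
  set C : ℂ_[p] := Ωp' / Ωp with hC
  have hC0 : C ≠ 0 := div_ne_zero hΩp' hΩp
  have hΩp'C : Ωp' = C * Ωp := by rw [hC, div_mul_cancel₀ _ hΩp]
  -- `y n = C^a · (C^b)^n · x n`
  have hxy : ∀ n, I n * Ωp' ^ (a + b * n) = C ^ a * (C ^ b) ^ n * (I n * Ωp ^ (a + b * n)) := by
    intro n
    rw [hΩp'C, mul_pow, ← pow_mul, ← pow_add]
    ring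
  have h1 : ‖C ^ b - 1‖ < 1 :=
    norm_sub_one_lt_one_of_values_mul_pow F F' hu (pow_ne_zero _ hC0) (pow_ne_zero _ hC0) hF hF'
      hxy (t₀ := n₀) (mul_ne_zero h0 (pow_ne_zero _ hΩp))
  have hCn : ‖C‖ = 1 := norm_eq_one_of_norm_pow_sub_one_lt_one hb h1
  refine ⟨hCn, h1, fun n ↦ ?_⟩
  rw [hxy n, norm_mul, norm_mul, norm_pow, norm_pow, norm_pow, hCn, one_pow, one_pow, one_pow,
    one_mul, one_mul]

end Summit.BirchSwinnertonDyer.BirchSwinnertonDyer.Theorems.CycTangentCMCycTangentBoundPeriodRigidity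

end
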